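import Literature.MathematicalPhysics.QuantumFieldTheory.Balaban1983to89.Beta.HessKerDressedLimit

/-!
# `BalabanUV.Beta.HessKerDressedUnits` — LEG UNITS: the diagonal rescaling of field / multiplier legs commutes with the chain-rule vertex,
# with an2's `Π`-dressing and with `hessKer` (asymptotic lane asym1, gen 14, v1, part 1 of 2; generic `d`; bookkeeping only)

HONEST FRAMING (cell contract, verbatim): «discharging `BetaPertH` makes Bałaban's UV stability UNCONDITIONAL — a real
constructive-QFT result; it is NOT the continuum limit and NOT the Clay problem.»  THIS MODULE is elementary algebra on matrix-fibred
lattice kernels (a diagonal conjugation commutes with traces, with the block-tree projector `Π` and with absolutely convergent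
superpositions); it formalises NO statement printed in Bałaban's papers, cites none as a hypothesis, mints no `Prop` fact, instantiates NO
binder of the wall and DISCHARGES NOTHING of it.  NOT summit progress.  Part 2 (`HessKerDressedUnitsWall`) carries the `d = 3` wall-level ENDs.

ABSOLUTE RULE (cell, verbatim): «No internally-minted statement may enter as a cited fact. Every hypothesis is either
kernel-proved in this package or a verbatim quotation of a PUBLISHED theorem with page reference. The manuscript(s) under
audit are NOT citable for their own disputed steps — they are the thing under adjudication; programme-internal
(2001/route/tribunal) claims are never citable.»  Every theorem below is kernel-proved from explicit, abstract hypotheses.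

PLACEMENT.  New cell work (our own lemmas about the cell's typed objects — a CELL RESULT, β-lead RULING (R34-2)), hence under the registered
cell topic `Summits/QuantumFields/BalabanUV/Beta/` (LEAN PLACEMENT RULE, human 2026-08-19); it IMPORTS the cell's `Literature/…/Balaban1983to89/
Beta/` leaves (landed before that rule; not moved, (R34-4)) and is imported by nothing under `Literature/`.  Two files ≤ 400 lines (cell-tree cap).

WHY (see part 2 for the wall-level consequence).  RULING (R25-1) poses (CONV-C) «for the RESCALED constituents `𝔄_j = u_j A_j u_j`»
(`HessKerRate` §5: `hessKer (uAu) (u′Vu′) (u′Wu′) = hessKer A V W`).  The typed wall primitives carry a `j`-DEPENDENT unit convention —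
`BalabanStepJetsSucc` v1.2, UNITS paragraph (PROVISIONAL there, quoted as motivation only): «`KInvStep Lc j = D K_j^{(1)} D` exactly»,
`D = diag(M⁻¹ on field legs, M^{−(d+1)} on multiplier legs)`, `M = Lc^j`, «`S_j = M^{d+2}·D⁻¹ S_j^{(1)} D⁻¹`», «`colH (D K D) = M^{−(d+2)}·colH K`».
This part types the LEG-UNIT MAPS on kernels, stencil tables and second-order tables for ARBITRARY nonzero units `(s_f, s_m)` and proves that
the dressed resolvent Hessian kernel is invariant under them; NO normalised object is named and NO exponent asserted (an4's / an2's (P6′)).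

CONTENT (five `def`s of OBJECTS — unit changes — and NO `Prop`): `legScale s_f s_m : Fib d → ℝ` (`D = diag(s_f ∣ s_m)`); `unitK s_f s_m K := D K D`
(`HessKerRate.scaleK` BY NAME), `counitK s_f s_m V := D⁻¹ V D⁻¹`, `unitS s_f s_m S κ u := (s_f s_m)⁻¹ • D⁻¹ (S κ u) D⁻¹`, `unitW s_f s_m W μ y ν y′ :=
D⁻¹ (W μ y ν y′) D⁻¹`; `colH_unitK` (`colH (DKD) = (s_f s_m) • colH K`), `wsum_smul_unitS`, **`vertexOfK_unit`** (`vertexOfK (DKD) N (unitS S) = D⁻¹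
(vertexOfK K N S) D⁻¹`), `legAx₂_scaleK` / `legAx₁_scaleK` / **`axDressK_unitK`** (`Π` commutes with leg-type-constant units: `AxialProjector.axProj_smul`
BY NAME), **`axVertexOfK_unit`**, the DRESSED UNITS INVARIANCE **`hessKer_dress_unit`** (`hessKer (Π(DKD)Π) (V^Π_{DKD}(unitS S)) (unitW W) = hessKer
(ΠKΠ) (V^Π_K S) W`, `s_f, s_m ≠ 0`; `HessKerRate.hessKer_scaleK` BY NAME), its undressed twin `hessKer_vertexOfK_unit`; unit `1` is the identity
(`unitK_one`, `unitS_one`, `unitW_one`); additivity `*_sub`; crude class transports `decays_unitK`, `biLoc_counitK`, `locStencil_unitS`,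
`vertexFamily₂_unitW` (`HessKerRate.decays_scaleK` / `biLoc_scaleK`; blockwise sharper factors are the supplier's bookkeeping).

RELATION TO THE TREE (no duplication): `HessKerRate` §5 (`scaleK`, `hessKer_scaleK`, `decays_scaleK`, `biLoc_scaleK`), `HessKerSchur` §8 (weighted
transports), an2's `AxialProjector` / `AxialDressing` / `OneStepKernelFamily` are USED BY NAME; new here are only the leg-unit maps on stencil / table
families and their commutation with the chain-rule vertex and the `Π`-dressing.  NOT continuum, NOT Clay.
-/

open Finset
open scoped BigOperators
open Literature.MathematicalPhysics.QuantumFieldTheory.Balaban1983to89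
open Literature.MathematicalPhysics.QuantumFieldTheory.Balaban1983to89.Beta
open ExpKernelCalculus (MKer Decays BiLoc VertexFamily₂ hessKer)
open HessKerRate (scaleK scaleK_apply hessKer_scaleK decays_scaleK biLoc_scaleK)
open OneStepResolventKernel (Fib wsum LocStencil)
open OneStepKernelFamily (colH vertexOfK)
open AxialDressing (legAx₁ legAx₂ legAx₁_inl legAx₁_inr legAx₂_inl legAx₂_inr axDressK axVertexOfK)
open AxialProjector (axProj axProj_smul)

namespace Summit.QuantumFields.BalabanUV.Beta.HessKerDressedUnits

/-! ## §1 Leg units: the diagonal rescaling of field / multiplier legs and its commutation with the vertex, the dressing and `hessKer` -/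

section LegUnits

variable {d : ℕ}

/-- [folklore] LEG-TYPE-CONSTANT UNITS on the fibre `Fib d = Fin (d+1) ⊕ Fin (d+1)`: the factor `sf` on the FIELD legs (`inl`), `sm` on the
MULTIPLIER legs (`inr`) — the diagonal `D = diag(s_f ∣ s_m)`. -/
def legScale (sf sm : ℝ) : Fib d → ℝ
  | Sum.inl _ => sf
  | Sum.inr _ => sm

/-- [folklore] `D` on a field leg. -/
@[simp] theorem legScale_inl (sf sm : ℝ) (α : Fin (d + 1)) : legScale (d := d) sf sm (Sum.inl α) = sf := rfl

/-- [folklore] `D` on a multiplier leg. -/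
@[simp] theorem legScale_inr (sf sm : ℝ) (m : Fin (d + 1)) : legScale (d := d) sf sm (Sum.inr m) = sm := rfl

/-- [folklore] `D · D⁻¹ = 1` legwise (nonzero units). -/
theorem legScale_mul_legScale_inv {sf sm : ℝ} (hsf : sf ≠ 0) (hsm : sm ≠ 0) (a : Fib d) :
    legScale sf sm a * legScale sf⁻¹ sm⁻¹ a = 1 := by
  cases a with
  | inl α => rw [legScale_inl, legScale_inl, mul_inv_cancel₀ hsf]
  | inr m => rw [legScale_inr, legScale_inr, mul_inv_cancel₀ hsm]

/-- [folklore] `D⁻¹ · D = 1` legwise (nonzero units). -/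
theorem legScale_inv_mul_legScale {sf sm : ℝ} (hsf : sf ≠ 0) (hsm : sm ≠ 0) (a : Fib d) :
    legScale sf⁻¹ sm⁻¹ a * legScale sf sm a = 1 := by
  rw [mul_comm]; exact legScale_mul_legScale_inv hsf hsm a

/-- [folklore] Unit `1` is the constant `1`. -/
theorem legScale_one (a : Fib d) : legScale (d := d) 1 1 a = 1 := by
  cases a with
  | inl α => rfl
  | inr m => rfl

/-- [folklore] `|D_a| ≤ max |s_f| |s_m|`. -/
theorem abs_legScale_le (sf sm : ℝ) (a : Fib d) : |legScale sf sm a| ≤ max |sf| |sm| := by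
  cases a with
  | inl α => rw [legScale_inl]; exact le_max_left _ _
  | inr m => rw [legScale_inr]; exact le_max_right _ _

/-- [folklore] CHANGE OF UNITS of a packed resolvent-type kernel: `unitK s_f s_m K := D K D` (`HessKerRate.scaleK`). -/
def unitK (sf sm : ℝ) (K : MKer (d + 1) (Fib d)) : MKer (d + 1) (Fib d) := scaleK (legScale sf sm) (legScale sf sm) K

/-- [folklore] The CONTRAGREDIENT change of units of a vertex-type kernel: `counitK s_f s_m V := D⁻¹ V D⁻¹`. -/
noncomputable def counitK (sf sm : ℝ) (V : MKer (d + 1) (Fib d)) : MKer (d + 1) (Fib d) :=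
  scaleK (legScale sf⁻¹ sm⁻¹) (legScale sf⁻¹ sm⁻¹) V

/-- [folklore] Change of units of a STENCIL TABLE: `unitS s_f s_m S κ u := (s_f·s_m)⁻¹ • D⁻¹ (S κ u) D⁻¹` — the stencil is conjugated
contragrediently AND divided by the factor `s_f·s_m` the `ℋ`-column of `D K D` picks up (`colH_unitK`), so that the chain-rule vertex
transforms contragrediently (`vertexOfK_unit`). -/
noncomputable def unitS (sf sm : ℝ) (S : Fin (d + 1) → (Fin (d + 1) → ℤ) → MKer (d + 1) (Fib d)) :
    Fin (d + 1) → (Fin (d + 1) → ℤ) → MKer (d + 1) (Fib d) :=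
  fun κ u => (sf * sm)⁻¹ • counitK sf sm (S κ u)

/-- [folklore] Change of units of a SECOND-ORDER TABLE: `unitW s_f s_m W μ y ν y′ := D⁻¹ (W μ y ν y′) D⁻¹`. -/
noncomputable def unitW (sf sm : ℝ) (W : Fin (d + 1) → (Fin (d + 1) → ℤ) → Fin (d + 1) → (Fin (d + 1) → ℤ) → MKer (d + 1) (Fib d)) :
    Fin (d + 1) → (Fin (d + 1) → ℤ) → Fin (d + 1) → (Fin (d + 1) → ℤ) → MKer (d + 1) (Fib d) :=
  fun μ y ν y' => counitK sf sm (W μ y ν y')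

/-- [folklore] Entries of `D K D`. -/
@[simp] theorem unitK_apply (sf sm : ℝ) (K : MKer (d + 1) (Fib d)) (x y : Fin (d + 1) → ℤ) (a b : Fib d) :
    unitK sf sm K x y a b = legScale sf sm a * K x y a b * legScale sf sm b := rfl

/-- [folklore] Entries of `D⁻¹ V D⁻¹`. -/
@[simp] theorem counitK_apply (sf sm : ℝ) (V : MKer (d + 1) (Fib d)) (x y : Fin (d + 1) → ℤ) (a b : Fib d) :
    counitK sf sm V x y a b = legScale sf⁻¹ sm⁻¹ a * V x y a b * legScale sf⁻¹ sm⁻¹ b := rfl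

/-- [folklore] Entries of the rescaled stencil table. -/
@[simp] theorem unitS_apply (sf sm : ℝ) (S : Fin (d + 1) → (Fin (d + 1) → ℤ) → MKer (d + 1) (Fib d)) (κ : Fin (d + 1))
    (u x y : Fin (d + 1) → ℤ) (a b : Fib d) :
    unitS sf sm S κ u x y a b = (sf * sm)⁻¹ * (legScale sf⁻¹ sm⁻¹ a * S κ u x y a b * legScale sf⁻¹ sm⁻¹ b) := rfl

/-- [folklore] Entries of the rescaled second-order table. -/
@[simp] theorem unitW_apply (sf sm : ℝ) (W : Fin (d + 1) → (Fin (d + 1) → ℤ) → Fin (d + 1) → (Fin (d + 1) → ℤ) → MKer (d + 1) (Fib d))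
    (μ : Fin (d + 1)) (y : Fin (d + 1) → ℤ) (ν : Fin (d + 1)) (y' : Fin (d + 1) → ℤ) (x z : Fin (d + 1) → ℤ) (a b : Fib d) :
    unitW sf sm W μ y ν y' x z a b = legScale sf⁻¹ sm⁻¹ a * W μ y ν y' x z a b * legScale sf⁻¹ sm⁻¹ b := rfl

/-- [folklore] Unit `1` changes nothing: `unitK 1 1 K = K`. -/
theorem unitK_one (K : MKer (d + 1) (Fib d)) : unitK 1 1 K = K := by
  funext x y a b
  rw [unitK_apply, legScale_one, legScale_one, one_mul, mul_one]

/-- [folklore] Unit `1` changes nothing: `counitK 1 1 V = V`. -/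
theorem counitK_one (V : MKer (d + 1) (Fib d)) : counitK 1 1 V = V := by
  funext x y a b
  rw [counitK_apply, inv_one, legScale_one, legScale_one, one_mul, mul_one]

/-- [folklore] Unit `1` changes nothing: `unitS 1 1 S = S`. -/
theorem unitS_one (S : Fin (d + 1) → (Fin (d + 1) → ℤ) → MKer (d + 1) (Fib d)) : unitS 1 1 S = S := by
  funext κ u x y a b
  simp only [unitS_apply, inv_one, legScale_one, mul_one, one_mul]

/-- [folklore] Unit `1` changes nothing: `unitW 1 1 W = W`. -/
theorem unitW_one (W : Fin (d + 1) → (Fin (d + 1) → ℤ) → Fin (d + 1) → (Fin (d + 1) → ℤ) → MKer (d + 1) (Fib d)) : unitW 1 1 W = W := by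
  funext μ y ν y'
  exact counitK_one (W μ y ν y')

/-- [folklore] The change of units is additive (same units): `unitK (K − K′) = unitK K − unitK K′`. -/
theorem unitK_sub (sf sm : ℝ) (K K' : MKer (d + 1) (Fib d)) : unitK sf sm (K - K') = unitK sf sm K - unitK sf sm K' := by
  funext x y a b
  simp only [unitK_apply, Pi.sub_apply]
  ring

/-- [folklore] `counitK (V − V′) = counitK V − counitK V′`. -/
theorem counitK_sub (sf sm : ℝ) (V V' : MKer (d + 1) (Fib d)) : counitK sf sm (V - V') = counitK sf sm V - counitK sf sm V' := by
  funext x y a b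
  simp only [counitK_apply, Pi.sub_apply]
  ring

/-- [folklore] `unitS (S − S′) = unitS S − unitS S′`. -/
theorem unitS_sub (sf sm : ℝ) (S S' : Fin (d + 1) → (Fin (d + 1) → ℤ) → MKer (d + 1) (Fib d)) :
    unitS sf sm (S - S') = unitS sf sm S - unitS sf sm S' := by
  funext κ u x y a b
  simp only [unitS_apply, Pi.sub_apply]
  ring

/-- [folklore] `unitW (W − W′) = unitW W − unitW W′`. -/
theorem unitW_sub (sf sm : ℝ) (W W' : Fin (d + 1) → (Fin (d + 1) → ℤ) → Fin (d + 1) → (Fin (d + 1) → ℤ) → MKer (d + 1) (Fib d)) :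
    unitW sf sm (W - W') = unitW sf sm W - unitW sf sm W' := by
  funext μ y ν y' x z a b
  simp only [unitW_apply, Pi.sub_apply]
  ring

/-- [folklore] **THE `ℋ`-COLUMN OF `D K D` IS `(s_f s_m) •` THE `ℋ`-COLUMN OF `K`** (the column sits on a (field, multiplier) block). -/
theorem colH_unitK (sf sm : ℝ) (K : MKer (d + 1) (Fib d)) (N : ℕ) (μ : Fin (d + 1)) (y : Fin (d + 1) → ℤ) :
    colH (unitK sf sm K) N μ y = (sf * sm) • colH K N μ y := by
  funext κ u
  simp only [colH, unitK_apply, legScale_inl, legScale_inr, Pi.smul_apply, smul_eq_mul]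
  ring

/-- [folklore] The weighted superposition of the rescaled stencils against `(s_f s_m) •` a weight is the contragredient conjugate of the
original superposition (the factor `(s_f s_m)⁻¹` of `unitS` cancels the column's factor; `tsum_mul_left/right`, NO summability needed). -/
theorem wsum_smul_unitS {sf sm : ℝ} (hsf : sf ≠ 0) (hsm : sm ≠ 0) (w : (Fin (d + 1) → ℤ) → ℝ)
    (S : Fin (d + 1) → (Fin (d + 1) → ℤ) → MKer (d + 1) (Fib d)) (κ : Fin (d + 1)) (x z : Fin (d + 1) → ℤ) (a b : Fib d) :
    wsum ((sf * sm) • w) (unitS sf sm S κ) x z a b = legScale sf⁻¹ sm⁻¹ a * wsum w (S κ) x z a b * legScale sf⁻¹ sm⁻¹ b := by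
  have hc : sf * sm ≠ 0 := mul_ne_zero hsf hsm
  simp only [wsum, Pi.smul_apply, smul_eq_mul, unitS_apply]
  rw [mul_assoc, ← tsum_mul_right, ← tsum_mul_left]
  refine tsum_congr fun u => ?_
  calc sf * sm * w u * ((sf * sm)⁻¹ * (legScale sf⁻¹ sm⁻¹ a * S κ u x z a b * legScale sf⁻¹ sm⁻¹ b))
      = sf * sm * (sf * sm)⁻¹ * (legScale sf⁻¹ sm⁻¹ a * (w u * S κ u x z a b * legScale sf⁻¹ sm⁻¹ b)) := by ring
    _ = legScale sf⁻¹ sm⁻¹ a * (w u * S κ u x z a b * legScale sf⁻¹ sm⁻¹ b) := by rw [mul_inv_cancel₀ hc, one_mul]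

/-- [folklore] **THE CHAIN-RULE VERTEX TRANSFORMS CONTRAGREDIENTLY**: `vertexOfK (D K D) N (unitS S) μ y = D⁻¹ (vertexOfK K N S μ y) D⁻¹`. -/
theorem vertexOfK_unit {sf sm : ℝ} (hsf : sf ≠ 0) (hsm : sm ≠ 0) (K : MKer (d + 1) (Fib d)) (N : ℕ)
    (S : Fin (d + 1) → (Fin (d + 1) → ℤ) → MKer (d + 1) (Fib d)) (μ : Fin (d + 1)) (y : Fin (d + 1) → ℤ) :
    vertexOfK (unitK sf sm K) N (unitS sf sm S) μ y = counitK sf sm (vertexOfK K N S μ y) := by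
  funext x z a b
  show (∑ κ' : Fin (d + 1), wsum (colH (unitK sf sm K) N μ y κ') (unitS sf sm S κ') x z a b) =
    legScale sf⁻¹ sm⁻¹ a * (∑ κ' : Fin (d + 1), wsum (colH K N μ y κ') (S κ') x z a b) * legScale sf⁻¹ sm⁻¹ b
  rw [colH_unitK, Finset.mul_sum, Finset.sum_mul]
  exact Finset.sum_congr rfl fun κ' _ => wsum_smul_unitS hsf hsm (colH K N μ y κ') S κ' x z a b

/-- [folklore] `Π` on the SECOND leg commutes with a rescaling whose right factor is leg-type-constant (`AxialProjector.axProj_smul`). -/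
theorem legAx₂_scaleK (N : ℕ) (l : Fib d → ℝ) (sf sm : ℝ) (A : MKer (d + 1) (Fib d)) :
    legAx₂ N (scaleK l (legScale sf sm) A) = scaleK l (legScale sf sm) (legAx₂ N A) := by
  funext x y a b
  cases b with
  | inl β =>
    rw [legAx₂_inl, scaleK_apply, legAx₂_inl, legScale_inl]
    have h : (fun β' y' => scaleK l (legScale sf sm) A x y' a (Sum.inl β')) = (l a * sf) • (fun β' y' => A x y' a (Sum.inl β')) := by
      funext β' y'
      simp only [scaleK_apply, legScale_inl, Pi.smul_apply, smul_eq_mul]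
      ring
    rw [h, axProj_smul, Pi.smul_apply, Pi.smul_apply, smul_eq_mul]
    ring
  | inr m => rw [legAx₂_inr, scaleK_apply, scaleK_apply, legAx₂_inr]

/-- [folklore] `Π` on the FIRST leg commutes with a rescaling whose left factor is leg-type-constant. -/
theorem legAx₁_scaleK (N : ℕ) (sf sm : ℝ) (r : Fib d → ℝ) (A : MKer (d + 1) (Fib d)) :
    legAx₁ N (scaleK (legScale sf sm) r A) = scaleK (legScale sf sm) r (legAx₁ N A) := by
  funext x y a b
  cases a with
  | inl α =>
    rw [legAx₁_inl, scaleK_apply, legAx₁_inl, legScale_inl]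
    have h : (fun α' x' => scaleK (legScale sf sm) r A x' y (Sum.inl α') b) = (sf * r b) • (fun α' x' => A x' y (Sum.inl α') b) := by
      funext α' x'
      simp only [scaleK_apply, legScale_inl, Pi.smul_apply, smul_eq_mul]
      ring
    rw [h, axProj_smul, Pi.smul_apply, Pi.smul_apply, smul_eq_mul]
    ring
  | inr m => rw [legAx₁_inr, scaleK_apply, scaleK_apply, legAx₁_inr]

/-- [folklore] **an2's `Π`-DRESSING COMMUTES WITH LEG UNITS**: `axDressK N (D K D) = D (axDressK N K) D`. -/
theorem axDressK_unitK (N : ℕ) (sf sm : ℝ) (K : MKer (d + 1) (Fib d)) : axDressK N (unitK sf sm K) = unitK sf sm (axDressK N K) := by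
  unfold axDressK unitK
  rw [legAx₂_scaleK, legAx₁_scaleK]

/-- [folklore] **THE `Π`-DRESSED CHAIN-RULE VERTEX TRANSFORMS CONTRAGREDIENTLY**:
`axVertexOfK (D K D) N (unitS S) μ y = D⁻¹ (axVertexOfK K N S μ y) D⁻¹` (`Π` is `ℝ`-linear on the `ℋ`-column: `axProj_smul`). -/
theorem axVertexOfK_unit {sf sm : ℝ} (hsf : sf ≠ 0) (hsm : sm ≠ 0) (K : MKer (d + 1) (Fib d)) (N : ℕ)
    (S : Fin (d + 1) → (Fin (d + 1) → ℤ) → MKer (d + 1) (Fib d)) (μ : Fin (d + 1)) (y : Fin (d + 1) → ℤ) :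
    axVertexOfK (unitK sf sm K) N (unitS sf sm S) μ y = counitK sf sm (axVertexOfK K N S μ y) := by
  funext x z a b
  show (∑ κ' : Fin (d + 1), wsum (axProj N (colH (unitK sf sm K) N μ y) κ') (unitS sf sm S κ') x z a b) =
    legScale sf⁻¹ sm⁻¹ a * (∑ κ' : Fin (d + 1), wsum (axProj N (colH K N μ y) κ') (S κ') x z a b) * legScale sf⁻¹ sm⁻¹ b
  rw [colH_unitK, axProj_smul, Finset.mul_sum, Finset.sum_mul]
  exact Finset.sum_congr rfl fun κ' _ => wsum_smul_unitS hsf hsm (axProj N (colH K N μ y) κ') S κ' x z a b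

/-- [folklore] **UNITS INVARIANCE OF THE DRESSED RESOLVENT HESSIAN KERNEL**: for nonzero leg units,
`hessKer (axDressK N (D K D)) (axVertexOfK (D K D) N (unitS S)) (unitW W) = hessKer (axDressK N K) (axVertexOfK K N S) W`
(`axDressK_unitK`, `axVertexOfK_unit`, then `HessKerRate.hessKer_scaleK` with `u = D`, `u′ = D⁻¹`). -/
theorem hessKer_dress_unit {sf sm : ℝ} (hsf : sf ≠ 0) (hsm : sm ≠ 0) (N : ℕ) (K : MKer (d + 1) (Fib d))
    (S : Fin (d + 1) → (Fin (d + 1) → ℤ) → MKer (d + 1) (Fib d))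
    (W : Fin (d + 1) → (Fin (d + 1) → ℤ) → Fin (d + 1) → (Fin (d + 1) → ℤ) → MKer (d + 1) (Fib d)) :
    hessKer (axDressK N (unitK sf sm K)) (axVertexOfK (unitK sf sm K) N (unitS sf sm S)) (unitW sf sm W) =
      hessKer (axDressK N K) (axVertexOfK K N S) W := by
  have hV : axVertexOfK (unitK sf sm K) N (unitS sf sm S) = fun μ y => counitK sf sm (axVertexOfK K N S μ y) :=
    funext fun μ => funext fun y => axVertexOfK_unit hsf hsm K N S μ y
  rw [axDressK_unitK, hV]
  exact hessKer_scaleK (legScale sf sm) (legScale sf⁻¹ sm⁻¹) (legScale_mul_legScale_inv hsf hsm) (axDressK N K) (axVertexOfK K N S) W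

/-- [folklore] The UNDRESSED twin: `hessKer (D K D) (vertexOfK (D K D) N (unitS S)) (unitW W) = hessKer K (vertexOfK K N S) W`. -/
theorem hessKer_vertexOfK_unit {sf sm : ℝ} (hsf : sf ≠ 0) (hsm : sm ≠ 0) (N : ℕ) (K : MKer (d + 1) (Fib d))
    (S : Fin (d + 1) → (Fin (d + 1) → ℤ) → MKer (d + 1) (Fib d))
    (W : Fin (d + 1) → (Fin (d + 1) → ℤ) → Fin (d + 1) → (Fin (d + 1) → ℤ) → MKer (d + 1) (Fib d)) :
    hessKer (unitK sf sm K) (vertexOfK (unitK sf sm K) N (unitS sf sm S)) (unitW sf sm W) = hessKer K (vertexOfK K N S) W := by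
  have hV : vertexOfK (unitK sf sm K) N (unitS sf sm S) = fun μ y => counitK sf sm (vertexOfK K N S μ y) :=
    funext fun μ => funext fun y => vertexOfK_unit hsf hsm K N S μ y
  rw [hV]
  exact hessKer_scaleK (legScale sf sm) (legScale sf⁻¹ sm⁻¹) (legScale_mul_legScale_inv hsf hsm) K (vertexOfK K N S) W

/-- [folklore] Crude class transport: `Decays K C δ → Decays (D K D) (U·C·U) δ`, `U = max |s_f| |s_m|` (`HessKerRate.decays_scaleK`;
blockwise sharper factors are the supplier's bookkeeping). -/
theorem decays_unitK {sf sm : ℝ} {K : MKer (d + 1) (Fib d)} {C δ : ℝ} (hK : Decays K C δ) :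
    Decays (unitK sf sm K) (max |sf| |sm| * C * max |sf| |sm|) δ :=
  decays_scaleK (abs_legScale_le sf sm) (abs_legScale_le sf sm) hK

/-- [folklore] Crude class transport: `BiLoc V p q C δ → BiLoc (D⁻¹ V D⁻¹) p q (U′·C·U′) δ`, `U′ = max |s_f⁻¹| |s_m⁻¹|`. -/
theorem biLoc_counitK {sf sm : ℝ} {V : MKer (d + 1) (Fib d)} {p q : Fin (d + 1) → ℤ} {C δ : ℝ} (hV : BiLoc V p q C δ) :
    BiLoc (counitK sf sm V) p q (max |sf⁻¹| |sm⁻¹| * C * max |sf⁻¹| |sm⁻¹|) δ :=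
  biLoc_scaleK (abs_legScale_le sf⁻¹ sm⁻¹) (abs_legScale_le sf⁻¹ sm⁻¹) hV

/-- [folklore] Crude class transport for stencil tables: `LocStencil S Cs δ → LocStencil (unitS S) (|(s_f s_m)⁻¹|·U′·Cs·U′) δ`. -/
theorem locStencil_unitS {sf sm : ℝ} {S : Fin (d + 1) → (Fin (d + 1) → ℤ) → MKer (d + 1) (Fib d)} {Cs δ : ℝ}
    (hS : LocStencil S Cs δ) :
    LocStencil (unitS sf sm S) (|(sf * sm)⁻¹| * (max |sf⁻¹| |sm⁻¹| * Cs * max |sf⁻¹| |sm⁻¹|)) δ := by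
  intro κ u x z a b
  have h := biLoc_counitK (sf := sf) (sm := sm) (hS κ u) x z a b
  rw [unitS_apply, ← counitK_apply, abs_mul, mul_assoc]
  exact mul_le_mul_of_nonneg_left h (abs_nonneg _)

/-- [folklore] Crude class transport for second-order tables: `VertexFamily₂ W N Cw δ → VertexFamily₂ (unitW W) N (U′·Cw·U′) δ`. -/
theorem vertexFamily₂_unitW {sf sm : ℝ}
    {W : Fin (d + 1) → (Fin (d + 1) → ℤ) → Fin (d + 1) → (Fin (d + 1) → ℤ) → MKer (d + 1) (Fib d)} {N : ℕ} {Cw δ : ℝ}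
    (hW : VertexFamily₂ W N Cw δ) : VertexFamily₂ (unitW sf sm W) N (max |sf⁻¹| |sm⁻¹| * Cw * max |sf⁻¹| |sm⁻¹|) δ :=
  fun μ y ν y' => biLoc_counitK (hW μ y ν y')

end LegUnits

end Summit.QuantumFields.BalabanUV.Beta.HessKerDressedUnits
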